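import Literature.Probability.Percolation.GladkovThreeClusterDichotomyProofs
import Mathlib.Tactic.Linarith
import HarnessLib

/-!
# `NoHeavyLowerTail` (stmt-CriticalPhenomena-4575), |A| = 5 glued rung — the apex-pair cells dominate Gladkov's
# two-configuration probability, and the REVERSE-HK reduction of the apex-pair lower bound `APL°`

Support file (prover seat `prim-ineq-gen-8`, gen 9; `--supports stmt-CriticalPhenomena-4575`).  No definitions, no named
facts, no sorries.  Memo: `run/shared/lean/prim/prim-ineq-gen-8/FINDING-gen9-THREEPORT.md` §3.

CONTEXT.  At a three-port observer the open row `Z(3,2)` (`OneCutFive.ZeroOneThree`) is, by `ThreePort.margin_eq` /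
`ThreePort.zeroOneThree_threePoint_row` (file `…OneCutFiveThreePort`), a statement about the three-point law
`(P(a|b|c), P(ab|c), P(ac|b), P(a|bc), P(abc))` of the graph off the observer, and numerically it follows from the
tree-proved rows of Gladkov–Zimin / Gladkov plus ANY apex-pair lower bound
`APL°(κ): P(ab|c) + P(ac|b) ≥ κ · P(a|b|c) · P(ab ∪ ac)` with `κ ≥ 0.3` (memo §2; conjectured infimum `2/3`).
This file records, in Gladkov's finite-weight formalism (`DecisionTree.PrW/Pr2W`, clusters `Gladkov.cl`, the
kept set `Gladkov.S3map` of the hybrid `C₁ →_{S₃} C₂`: keep the clusters of `y, z`, resample the cluster of `x` and the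
rest), the inequality that §7.1 of [Gladkov2024] proves on the way to Lemma 1.2 but does not display:

* `ThreePort.apexPair_ge_Pr2W_tri_S3` — `P(xy|z) + P(xz|y) ≥ P(C₁ ∈ x|y|z, C₁ →_{S₃} C₂ ∈ xy ∪ xz)`
  (Lemma 7.1 + the Cauchy–Schwarz bound Thm. 5.2, tree lemmas `Gladkov.Pr2W_tri_S3_le`, `Gladkov.sq_PrW_tri_le`,
  `Gladkov.Pr2W_add_Pr2W_le_PrW_tri`; the elementary step `M₁ ≤ P(x|y|z) − P(x|y|z)²/P(z|x ∩ z|y) ≤ P(z|x ∩ z|y) − P(x|y|z) = P(xy|z)`);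
* `ThreePort.apexPair_lower_of_reverseHK` — hence a REVERSE decision-tree Harris–Kleitman inequality for this one tree,
  `P(C₁ ∈ x|y|z, C₁ →_{S₃} C₂ ∈ xy ∪ xz) ≥ κ · P(x|y|z) · P(xy ∪ xz)`, implies `APL°(κ)`.  (By Lemma 3.1 the same
  two-configuration probability over `C₁ ∈ x|y ∩ x|z` EQUALS `P(x|y ∩ x|z)·P(xy ∪ xz)` (`Gladkov.Pr2W_iso_S3_eq`), and the
  decision-tree HK inequality (Gladkov Thm. 3.2) bounds the `x|y|z`-part ABOVE by `P(x|y|z)·P(xy ∪ xz)`; the memo's data: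
  the ratio is `8/9` on the V-shape, `0.886–0.893` on the hub clouds `K_{3,k}`, and tends to the APL ratio `Φ` under a pendant apex.)
HONEST LABEL: the reverse-HK hypothesis is OPEN (it is the memo's conjecture `inf = 2/3`); nothing here asserts it.
[cite: Gladkov2024, §7.1 (pp. 11–12), Lemma 7.1, Thm. 5.2, Thm. 3.2]
-/

noncomputable section

namespace Summit.CriticalPhenomena.PercolationContinuityZ3.Theorems

namespace ThreePort

open Finset Literature.Probability.Percolation Literature.Probability.Percolation.DecisionTree
  Literature.Probability.Percolation.Gladkov
open scoped Classical

variable {V : Type*} [Fintype V] [DecidableEq V]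

/-- **The apex-pair cells dominate the two-configuration probability.**  For finite weights `p ∈ [0,1]` on the pairs of
`V` and vertices `x, y, z`:
`P(C₁ ∈ x|y|z, C₁ →_{S₃} C₂ ∈ xy ∪ xz) ≤ [P(z|x ∩ z|y) − P(x|y|z)] + [P(y|x ∩ y|z) − P(x|y|z)] = P(xy|z) + P(xz|y)`.
Proof: Lemma 7.1 bounds the left side by `M₁ + M₂`, `M₁ = P(C₁ ∈ x|y|z, C₁ →_{S₁} C₂ ∈ xy)`; by Thm. 5.2
`P(x|y|z)² ≤ P(z|x ∩ z|y)·P(C₁ ∈ x|y|z, C₁ →_{S₁} C₂ ∈ x|y|z)` and `M₁ + P(C₁ ∈ x|y|z, C₁ →_{S₁} C₂ ∈ x|y|z) ≤ P(x|y|z)`,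
whence `P(z|x ∩ z|y)·M₁ ≤ P(x|y|z)·(P(z|x ∩ z|y) − P(x|y|z))` and `M₁ ≤ P(z|x ∩ z|y) − P(x|y|z)`.
[cite: Gladkov2024, §7.1 (pp. 11–12)] -/
theorem apexPair_ge_Pr2W_tri_S3 {p : Sym2 V → ℝ} (hp0 : ∀ i, 0 ≤ p i) (hp1 : ∀ i, p i ≤ 1) (x y z : V) :
    Pr2W Finset.univ p {w | w.1 ∈ tri x y z ∧ splice (S3map x y z w.1) w.1 w.2 ∈ conn x y ∪ conn x z} ≤
      (PrW Finset.univ p (iso z x y) - PrW Finset.univ p (tri x y z)) +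
        (PrW Finset.univ p (iso y x z) - PrW Finset.univ p (tri x y z)) := by
  have hA := sq_PrW_tri_le hp0 hp1 x y z
  have hB := sq_PrW_tri_le hp0 hp1 x z y
  rw [tri_swap] at hB
  have h1 := Pr2W_tri_S3_le hp0 hp1 x y z
  have h5 := Pr2W_add_Pr2W_le_PrW_tri hp0 hp1 x y z (S1map x y z)
  have h6 := Pr2W_add_Pr2W_le_PrW_tri hp0 hp1 x z y (S1map x z y)
  rw [tri_swap] at h6
  -- abbreviations
  set t := PrW Finset.univ p (tri x y z) with ht
  set sz := PrW Finset.univ p (iso z x y) with hsz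
  set sy := PrW Finset.univ p (iso y x z) with hsy
  set M₁ := Pr2W Finset.univ p {w | w.1 ∈ tri x y z ∧ splice (S1map x y z w.1) w.1 w.2 ∈ conn x y} with hM₁
  set M₂ := Pr2W Finset.univ p {w | w.1 ∈ tri x y z ∧ splice (S1map x z y w.1) w.1 w.2 ∈ conn x z} with hM₂
  set P₁ := Pr2W Finset.univ p {w | w.1 ∈ tri x y z ∧ splice (S1map x y z w.1) w.1 w.2 ∈ tri x y z} with hP₁
  set P₂ := Pr2W Finset.univ p {w | w.1 ∈ tri x y z ∧ splice (S1map x z y w.1) w.1 w.2 ∈ tri x y z} with hP₂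
  have ht0 : 0 ≤ t := PrW_nonneg _ hp0 hp1 _
  have htz : t ≤ sz := PrW_mono _ hp0 hp1 fun S _ hS => tri_subset_iso' x y z hS
  have hty : t ≤ sy := by
    refine PrW_mono _ hp0 hp1 fun S _ hS => ?_
    have hS' : S ∈ tri x z y := by rw [tri_swap]; exact hS
    exact tri_subset_iso' x z y hS'
  -- `sz·M₁ ≤ t(sz − t)` and `M₁ ≤ sz − t`
  have hM₁ : M₁ ≤ sz - t := by
    have h7 : sz * M₁ ≤ t * (sz - t) := by nlinarith [hA, h5, PrW_nonneg Finset.univ hp0 hp1 (iso z x y)]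
    by_cases hs : sz = 0
    · have : t = 0 := le_antisymm (hs ▸ htz) ht0
      have hP : 0 ≤ P₁ := Pr2W_nonneg _ hp0 hp1 _
      linarith
    · have hspos : 0 < sz := lt_of_le_of_ne (PrW_nonneg _ hp0 hp1 _) (Ne.symm hs)
      have h8 : sz * M₁ ≤ sz * (sz - t) := by nlinarith
      exact le_of_mul_le_mul_left h8 hspos
  have hM₂ : M₂ ≤ sy - t := by
    have h7 : sy * M₂ ≤ t * (sy - t) := by nlinarith [hB, h6, PrW_nonneg Finset.univ hp0 hp1 (iso y x z)]
    by_cases hs : sy = 0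
    · have : t = 0 := le_antisymm (hs ▸ hty) ht0
      have hP : 0 ≤ P₂ := Pr2W_nonneg _ hp0 hp1 _
      linarith
    · have hspos : 0 < sy := lt_of_le_of_ne (PrW_nonneg _ hp0 hp1 _) (Ne.symm hs)
      have h8 : sy * M₂ ≤ sy * (sy - t) := by nlinarith
      exact le_of_mul_le_mul_left h8 hspos
  linarith

/-- **`APL°` from a reverse decision-tree Harris–Kleitman inequality for the tree `S₃`.**  If, for finite weights `p ∈ [0,1]`
and vertices `x, y, z`, the two-configuration probability `P(C₁ ∈ x|y|z, C₁ →_{S₃} C₂ ∈ xy ∪ xz)` is at least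
`κ · P(x|y|z) · P(xy ∪ xz)` (a REVERSE form of Gladkov's Thm. 3.2 for this one tree and this one pair of events), then the
apex-pair lower bound holds with the same constant: `P(xy|z) + P(xz|y) ≥ κ · P(x|y|z) · P(xy ∪ xz)`.  (Here
`P(xy|z) = P(z|x ∩ z|y) − P(x|y|z)` and `P(xz|y) = P(y|x ∩ y|z) − P(x|y|z)`.)  HONEST LABEL: the hypothesis is open.
[this work; cite: Gladkov2024, §7.1, Thm. 3.2] -/
theorem apexPair_lower_of_reverseHK {p : Sym2 V → ℝ} (hp0 : ∀ i, 0 ≤ p i) (hp1 : ∀ i, p i ≤ 1) (x y z : V)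
    {κ : ℝ}
    (hrev : κ * PrW Finset.univ p (tri x y z) * PrW Finset.univ p (conn x y ∪ conn x z) ≤
      Pr2W Finset.univ p {w | w.1 ∈ tri x y z ∧ splice (S3map x y z w.1) w.1 w.2 ∈ conn x y ∪ conn x z}) :
    κ * PrW Finset.univ p (tri x y z) * PrW Finset.univ p (conn x y ∪ conn x z) ≤
      (PrW Finset.univ p (iso z x y) - PrW Finset.univ p (tri x y z)) +
        (PrW Finset.univ p (iso y x z) - PrW Finset.univ p (tri x y z)) :=
  hrev.trans (apexPair_ge_Pr2W_tri_S3 hp0 hp1 x y z)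

end ThreePort

end Summit.CriticalPhenomena.PercolationContinuityZ3.Theorems

end
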